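import Literature.RepresentationTheory.HeisenbergGroup.DoubledDeltaPolarisation
import Literature.RepresentationTheory.HeisenbergGroup.SchrodingerIsotropicEigenfunctional
import HarnessLib

/-!
# `(g ⊕ 1) · ℓ_Δ` in the `ℓ_Δ`-adapted coordinates is the graph of the Cayley transform of `g`

Topic `RepresentationTheory/HeisenbergGroup`; namespace `Literature.RepresentationTheory.HeisenbergGroup`.  KERNEL ONLY
(theorems, pure algebra over a commutative ring `K` with `⅟2`; no definition, no named fact).

Setting of `DoubledDeltaPolarisation.lean`: `e : κ ⊕ κ ≃ ι`, `T₀ : Matrix κ κ K`, the doubled Gram matrix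
`T = reindex e e (T₀ ⊕ (−T₀))` (`hT`), `𝕎 = K^ι × K^ι ⊃ ℓ_Δ = {deltaW α β}`, `ℓ_∇ = {nablaW a b}`, the adapted
coordinates `deltaCoords : 𝕎 ≃ X_Δ × Y_Δ` and Gram matrix `deltaGram e T₀ = J_Δ`, and the isomorphism
`deltaHeisenbergEquiv : H(polar β_T) ≃* H(polar β_Δ)`.  Let `g` be a linear automorphism of the FIRST block
`𝕎₁ = K^κ × K^κ` and `C` an «inverse-free Cayley transform» of `g`: a linear map with `C (g w − w) = g w + w` for all
`w` (so `C = (g + 1)(g − 1)⁻¹` when `g − 1` is invertible).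

* §1 `apply_eq_add_of_two_smul_eq_sub` — if `2x = g w − w` then `C x = w + x` (and `g w = w + 2x`);
* §2 **`deltaCoords_inlW_deltaW`** — for `2x = g(α, β) − (α, β)`:
  `deltaCoords ((g ⊕ 1)(deltaW α β)) = (x.1 ⊔ x.2, (C x).1 ⊔ (C x).2)`, i.e. `(g ⊕ 1) · ℓ_Δ`, read in the
  coordinates `X_Δ × Y_Δ`, is the GRAPH `{(x, C x)}` of the Cayley transform (`exists_deltaCoords_inlW_deltaW_eq`:
  every point of the graph is attained when `w ↦ g w − w` is onto);
* §3 **`toLinearMap₂'_deltaGram_glue_cayley_symm`** — for `g` symplectic (`alt (polar β_{T₀})`-isometric) with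
  `w ↦ g w − w` onto, the graph is `β_Δ`-SYMMETRIC: `β_Δ(x ⊔, C x' ⊔) = β_Δ(x' ⊔, C x ⊔)` (it is a Lagrangian);
* §4 `deltaHeisenbergEquiv_mk_half` — `Φ_Δ (w, ½ β_T(w, w)) = (deltaCoords w, ½ β_Δ(deltaCoords w))`: the change of
  polarisation carries Weil's canonical lift of `polar β_T` to that of `polar β_Δ`;
* §5 **`deltaHeisenbergEquiv_act_spInl_deltaW`** (what the doubling assembly consumes) — for
  `g₁ ∈ Sp(polar β_{T₀})`: `Φ_Δ ((ofSymplectic (g₁ ⊕ 1)) · (deltaW α β, 0)) = ((x ⊔, C x ⊔), ½ β_Δ(x ⊔, C x ⊔))`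
  under `2x = g₁(α, β) − (α, β)` (`toLinearMap₂'_delta_delta`, `act_ofSymplectic_mk_half`, §2, §4).

This is the linear algebra of the basic identity of the doubling method — `(g, 1) · ℓ_Δ ∩ ℓ_Δ = 0` iff `g − 1` is
invertible, and then `(g, 1) · ℓ_Δ` is the graph of the Cayley transform — [Kudla1994, §2], [HarrisKudlaSweet1996,
§1], in the coordinates of the tree.  Written for the cell `hodgecm-mathlib` (fan B, rung B-IV, KEY
`b4-howe-compact-irreducible`, helper H16 of the doubling proof of
`MoeglinVignerasWaldspurger1987.mvw_IV4_rankOne_irreducibleOrZero`).  Nothing about theta lifts is asserted here.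

## References
* [Kudla1994] S. Kudla, *Splitting metaplectic covers of dual reductive pairs*, Israel J. Math. 87 (1994), §2.
* [HarrisKudlaSweet1996] M. Harris, S. Kudla, W. Sweet, J. AMS 9 (1996), §1 (1.9)–(1.11).
* [MoeglinVignerasWaldspurger1987] C. Mœglin, M.-F. Vignéras, J.-L. Waldspurger, LNM 1291 (1987), Chap. 2 I.7, II.1.
* [Weil1964] A. Weil, Acta Math. 111 (1964), n° 5.
-/

set_option autoImplicit false

namespace Literature.RepresentationTheory.HeisenbergGroup

open Literature.NumberTheory.Automorphic

section CayleyGraph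

variable {K : Type*} [CommRing K] [Invertible (2 : K)] {κ ι : Type*} [Fintype κ] [Fintype ι] [DecidableEq κ]
  [DecidableEq ι] (e : κ ⊕ κ ≃ ι) (T₀ : Matrix κ κ K) {T : Matrix ι ι K}
  (hT : T = Matrix.reindex e e (Matrix.fromBlocks T₀ 0 0 (-T₀)))
  {g : ((κ → K) × (κ → K)) ≃ₗ[K] ((κ → K) × (κ → K))} {C : ((κ → K) × (κ → K)) →ₗ[K] ((κ → K) × (κ → K))}
  (hC : ∀ w, C (g w - w) = g w + w)

/-! ## §1 The inverse-free Cayley transform on half-differences -/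

omit [Fintype κ] [DecidableEq κ] [Invertible (2 : K)] in
/-- `2x = g w − w ⟹ g w = w + 2x`. [cite: Kudla1994, §2] -/
theorem apply_eq_add_two_smul_of_two_smul_eq_sub (x w : (κ → K) × (κ → K)) (hx : (2 : K) • x = g w - w) :
    g w = w + (2 : K) • x := by
  rw [hx, add_sub_cancel]

omit [Fintype κ] [DecidableEq κ] in
include hC in
/-- **`2x = g w − w ⟹ C x = w + x`** (from `C(g w − w) = g w + w = 2w + 2x` and `⅟2`). [cite: Kudla1994, §2] -/
theorem apply_eq_add_of_two_smul_eq_sub (x w : (κ → K) × (κ → K)) (hx : (2 : K) • x = g w - w) :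
    C x = w + x := by
  have h1 : (2 : K) • C x = (2 : K) • (w + x) := by
    rw [← LinearMap.map_smul, hx, hC, smul_add, hx, two_smul]
    abel
  have h2 := congrArg (fun v => (⅟(2 : K)) • v) h1
  simpa only [smul_smul, invOf_mul_self, one_smul] using h2

/-! ## §2 `(g ⊕ 1) · ℓ_Δ` in the adapted coordinates: the graph of `C` -/

omit [Fintype κ] [Fintype ι] [DecidableEq κ] [DecidableEq ι] in
include hC in
/-- **`deltaCoords ((g ⊕ 1)(deltaW α β)) = (x.1 ⊔ x.2, (C x).1 ⊔ (C x).2)` for `2x = g(α, β) − (α, β)`**: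
`(g ⊕ 1)(α ⊔ α, β ⊔ β) = ((α + 2x₁) ⊔ α, (β + 2x₂) ⊔ β) = nablaW x + deltaW (C x)` with `C x = (α, β) + x`.
[cite: Kudla1994, §2] -/
theorem deltaCoords_inlW_deltaW (α β : κ → K) (x : (κ → K) × (κ → K)) (hx : (2 : K) • x = g (α, β) - (α, β)) :
    deltaCoords e (inlW e g (deltaW e α β)) = (glue e x.1 x.2, glue e (C x).1 (C x).2) := by
  have hCx : C x = (α, β) + x := apply_eq_add_of_two_smul_eq_sub hC x (α, β) hx
  have hg : g (α, β) = (α, β) + (2 : K) • x := apply_eq_add_two_smul_of_two_smul_eq_sub x (α, β) hx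
  have h1 : ∀ a y : κ → K, a + (2 : K) • y = y + (a + y) := fun a y => by
    funext i; simp only [Pi.add_apply, Pi.smul_apply, smul_eq_mul]; ring
  have h2 : ∀ a y : κ → K, -y + (a + y) = a := fun a y => by
    funext i; simp only [Pi.add_apply, Pi.neg_apply]; ring
  have key : inlW e g (deltaW e α β) = nablaW e x.1 x.2 + deltaW e (C x).1 (C x).2 := by
    rw [nablaW_add_deltaW, hCx]
    simp only [deltaW, inlW_apply_glue, hg, Prod.fst_add, Prod.snd_add, Prod.smul_fst, Prod.smul_snd, h1, h2]
  rw [key, map_add, deltaCoords_nablaW, deltaCoords_deltaW, Prod.mk_add_mk, add_zero, zero_add]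

omit [Fintype κ] [Fintype ι] [DecidableEq κ] [DecidableEq ι] in
include hC in
/-- **every point `(x, C x)` of the graph is `deltaCoords` of a point of `(g ⊕ 1) · ℓ_Δ`** when `w ↦ g w − w` is
onto (i.e. `g − 1` invertible). [cite: Kudla1994, §2] -/
theorem exists_deltaCoords_inlW_deltaW_eq (hs : Function.Surjective fun w => g w - w) (x : (κ → K) × (κ → K)) :
    ∃ α β : κ → K, deltaCoords e (inlW e g (deltaW e α β)) = (glue e x.1 x.2, glue e (C x).1 (C x).2) := by
  obtain ⟨w, hw⟩ := hs ((2 : K) • x)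
  exact ⟨w.1, w.2, deltaCoords_inlW_deltaW e hC w.1 w.2 x hw.symm⟩

/-! ## §3 The graph is `β_Δ`-symmetric for symplectic `g` -/

omit [Invertible (2 : K)] in
include hC in
/-- **symmetry of `β_Δ` on the Cayley graph**: for `g` an isometry of the alternating form `alt (polar β_{T₀})` (i.e.
`g ∈ Sp(W_{T₀})`, `mem_symplecticGroup`) with `w ↦ g w − w` onto,
`β_Δ(x.1 ⊔ x.2, (C x').1 ⊔ (C x').2) = β_Δ(x'.1 ⊔ x'.2, (C x).1 ⊔ (C x).2)` — both sides are
`2·alt(g w, w') − 2·alt(w, g w')` for `x = g w − w`, `x' = g w' − w'` (`deltaGram_glue`). [cite: Kudla1994, §2] -/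
theorem toLinearMap₂'_deltaGram_glue_cayley_symm
    (hg : ∀ w w', alt (polar (Matrix.toLinearMap₂' K T₀)) (g w) (g w') = alt (polar (Matrix.toLinearMap₂' K T₀)) w w')
    (hs : Function.Surjective fun w => g w - w) (x x' : (κ → K) × (κ → K)) :
    Matrix.toLinearMap₂' K (deltaGram e T₀) (glue e x.1 x.2) (glue e (C x').1 (C x').2) =
      Matrix.toLinearMap₂' K (deltaGram e T₀) (glue e x'.1 x'.2) (glue e (C x).1 (C x).2) := by
  obtain ⟨w, rfl⟩ := hs x
  obtain ⟨w', rfl⟩ := hs x'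
  have h := hg w w'
  simp only [alt_apply, polar_apply] at h
  simp only [hC, deltaGram_glue, Prod.fst_sub, Prod.snd_sub, Prod.fst_add, Prod.snd_add, map_sub, map_add,
    LinearMap.sub_apply, LinearMap.add_apply]
  linear_combination (4 : K) * h

/-! ## §4 The change of polarisation on Weil's canonical lift -/

/-- **`Φ_Δ (w, ½ β_T(w.1, w.2)) = (deltaCoords w, ½ β_Δ((deltaCoords w).1, (deltaCoords w).2))`** — immediate from
`deltaCorrection w = ½ (β_Δ(deltaCoords w) − β_T(w))`. [cite: MoeglinVignerasWaldspurger1987, Chap. 2 I.7] -/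
theorem deltaHeisenbergEquiv_mk_half (w : (ι → K) × (ι → K)) :
    deltaHeisenbergEquiv e T₀ hT ⟨w, ⅟(2 : K) * Matrix.toLinearMap₂' K T w.1 w.2⟩ =
      ⟨deltaCoords e w,
        ⅟(2 : K) * Matrix.toLinearMap₂' K (deltaGram e T₀) (deltaCoords e w).1 (deltaCoords e w).2⟩ := by
  apply Heisenberg.ext
  · rfl
  · rw [deltaHeisenbergEquiv_t]
    show ⅟(2 : K) * Matrix.toLinearMap₂' K T w.1 w.2 + deltaCorrection e T₀ (T := T) w = _
    rw [deltaCorrection, deltaPulledCocycle_apply, polar_apply]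
    ring

/-! ## §5 Combined: `Φ_Δ((g₁ ⊕ 1) · (deltaW α β, 0))` -/

/-- **what the doubling assembly consumes**: for `g₁ ∈ Sp(W_{T₀})` acting on the first block of the doubled space
(`spInl`, i.e. `g₁ ⊕ 1`) through Weil's section `ofSymplectic`, and `C` with `C (g₁ w − w) = g₁ w + w`,
`Φ_Δ ((ofSymplectic (g₁ ⊕ 1)) · (deltaW α β, 0))`
`= ((x.1 ⊔ x.2, (C x).1 ⊔ (C x).2), ½ β_Δ(x.1 ⊔ x.2, (C x).1 ⊔ (C x).2))`
whenever `2x = g₁(α, β) − (α, β)`: the image of the modulation Lagrangian `ℓ_Δ` under `g₁ ⊕ 1` is Weil's canonical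
lift of the graph of the Cayley transform. [cite: Kudla1994, §2] -/
theorem deltaHeisenbergEquiv_act_spInl_deltaW (g₁ : symplecticGroup (polar (Matrix.toLinearMap₂' K T₀)))
    {C₁ : ((κ → K) × (κ → K)) →ₗ[K] ((κ → K) × (κ → K))} (hC₁ : ∀ w, C₁ (g₁.1 w - w) = g₁.1 w + w)
    (α β : κ → K) (x : (κ → K) × (κ → K)) (hx : (2 : K) • x = g₁.1 (α, β) - (α, β)) :
    deltaHeisenbergEquiv e T₀ hT ((ofSymplectic _ (spInl e T₀ (-T₀) hT g₁)).act ⟨deltaW e α β, 0⟩) =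
      ⟨(glue e x.1 x.2, glue e (C₁ x).1 (C₁ x).2),
        ⅟(2 : K) * Matrix.toLinearMap₂' K (deltaGram e T₀) (glue e x.1 x.2) (glue e (C₁ x).1 (C₁ x).2)⟩ := by
  have h0 : (⟨deltaW e α β, 0⟩ : Heisenberg (polar (Matrix.toLinearMap₂' K T))) =
      ⟨deltaW e α β, ⅟(2 : K) * polar (Matrix.toLinearMap₂' K T) (deltaW e α β) (deltaW e α β)⟩ := by
    rw [polar_deltaW_deltaW e T₀ hT, mul_zero]
  rw [h0, act_ofSymplectic_mk_half, coe_spInl, polar_apply, deltaHeisenbergEquiv_mk_half e T₀ hT,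
    deltaCoords_inlW_deltaW e hC₁ α β x hx]

/-- the same with an arbitrary central component `t`: `Φ_Δ ((ofSymplectic (g₁ ⊕ 1)) · (deltaW α β, t)) =
((x ⊔, C x ⊔), t + ½ β_Δ(x ⊔, C x ⊔))`. [cite: Kudla1994, §2] -/
theorem deltaHeisenbergEquiv_act_spInl_deltaW_t (g₁ : symplecticGroup (polar (Matrix.toLinearMap₂' K T₀)))
    {C₁ : ((κ → K) × (κ → K)) →ₗ[K] ((κ → K) × (κ → K))} (hC₁ : ∀ w, C₁ (g₁.1 w - w) = g₁.1 w + w)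
    (α β : κ → K) (t : K) (x : (κ → K) × (κ → K)) (hx : (2 : K) • x = g₁.1 (α, β) - (α, β)) :
    deltaHeisenbergEquiv e T₀ hT ((ofSymplectic _ (spInl e T₀ (-T₀) hT g₁)).act ⟨deltaW e α β, t⟩) =
      ⟨(glue e x.1 x.2, glue e (C₁ x).1 (C₁ x).2),
        t + ⅟(2 : K) * Matrix.toLinearMap₂' K (deltaGram e T₀) (glue e x.1 x.2) (glue e (C₁ x).1 (C₁ x).2)⟩ := by
  have hmul : (⟨deltaW e α β, t⟩ : Heisenberg (polar (Matrix.toLinearMap₂' K T))) =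
      ⟨0, t⟩ * ⟨deltaW e α β, 0⟩ := by
    apply Heisenberg.ext
    · exact (zero_add _).symm
    · simp only [Heisenberg.mul_t, map_zero, LinearMap.zero_apply, add_zero]
  have hcen : (ofSymplectic _ (spInl e T₀ (-T₀) hT g₁)).act ⟨0, t⟩ =
      (⟨0, t⟩ : Heisenberg (polar (Matrix.toLinearMap₂' K T))) := by
    apply Heisenberg.ext
    · exact map_zero _
    · simp only [Heisenberg.PseudoSymplectic.act_t, ofSymplectic_f, map_zero, sub_self, mul_zero, add_zero]
  rw [hmul, Heisenberg.PseudoSymplectic.act_mul, map_mul, hcen,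
    deltaHeisenbergEquiv_act_spInl_deltaW e T₀ hT g₁ hC₁ α β x hx, deltaHeisenbergEquiv_center]
  apply Heisenberg.ext
  · exact zero_add _
  · simp only [Heisenberg.mul_t, map_zero, LinearMap.zero_apply, add_zero]

end CayleyGraph

end Literature.RepresentationTheory.HeisenbergGroup
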